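import Summits.ResolutionOfSingularities.ResolutionOfSingularities.Theorems.PurelyInseparableDim4UnionLaw
import Summits.ResolutionOfSingularities.ResolutionOfSingularities.Theorems.PurelyInseparableDim4ComponentThreadsExact
import HarnessLib

/-!
# [OURS · res-dim4-pi · F4-C] UNION-LAW RUNS HAVE NO CYCLES, ONLY FIXED POINTS (every field, every `q`): along a
  spine run in which every chart misses a coordinate set of degree `≥ q`, the total degree mass of the support
  never decreases, so a periodic run is stationary — the reason the crossing-line hunts find regions of size 1

Cell `res-dim4-pi` (D-0157 DOOR 2, wave 2), seat `res-dim4-p-6` g2; sequel of `…UnionLaw` (p665469 at filing: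
`le_chartExponent_of_le` — if every monomial has `(U ∖ {j})`-degree `≥ q`, NO exponent drops in the `x_j`-chart of
the blow-up of `C_U`; `chartExponent_eq_self_iff`).  Census context: idea-2 g3's LOCAL hunt under the
crossings-first rule R_X at `(3,3)` found «40 regions, ALL of size 1 = FIXED POINTS» (bus 20:14:35Z); crit-1's
V-A-30 (L) `P₁`, p-8 g2's FIX-X.  This file is the structural reason on the SPINE (`b = 0`):

* §1 **degree mass.** `degMass F = Σ_{α ∈ supp F} |α|`.  For a clean `F` with `q ≤ ord_U F` and the union-law
  inequality `q ≤ |α|_{U∖j}` on every monomial, the spine child `F' = deletePthPowers q (chartTransform q U j F)`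
  is `chartTransform q U j F` itself (the chart transform of a clean permissible parent is clean,
  `Perm2Bound.deletePthPowers_chartTransform`), its support is the INJECTIVE image of `supp F` under an
  exponent map that is `≥ id` coordinatewise (`chartExponent_injOn`, `support_spineChild`), hence
  **`degMass_le_and_eq_iff`**: `degMass F ≤ degMass F'`, with equality iff the chart transform is the identity
  on `F`.
* §2 **`spineRun_stationary_of_periodic`**: a spine run `F (k+1) = deletePthPowers q (chartTransform q (U k) (j k)
  (F k))`, clean at the start, permissible and union-law at every step, with `F n = F 0` for some `n ≥ 1`, is
  STATIONARY: `F (k+1) = F k` for all `k < n` (indeed every chart transform on the way is the identity).  So under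
  such centre choices B's spine replies produce no cycle other than a fixed point.
* §3 **crossing lines**: if `U = S₁ ∪ S₂` with BOTH `S₁`, `S₂` permissible and the chart misses one of them
  (`j ∉ S₁` or `j ∉ S₂`), the union-law inequality holds automatically (`unionLaw_of_crossing`); hence
  **`crossing_spineRun_stationary_of_periodic`** — periodic spine runs of any crossing-line rule whose charts avoid
  `S₁ ∩ S₂` are fixed points (the located ones: `CrossingFix.P1/P/Q`, `FixX`).  Charts in `S₁ ∩ S₂` are NOT
  covered (there progress is possible; e.g. the `x₁`-chart at `P₁` is not even equimultiple).

Scope (honest): SPINE replies (`b = 0`) only; fibre and hop replies are not touched; statements about OUR frame.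
[OURS · counted 0 · elementary; AI kernel work, weaker than expert review.]  NOTHING here is a statement about
resolution of singularities; resolution in dimension `≥ 4` / characteristic `p > 0` is NOT proved by anything in
this file.  bears_on: LADDER-RESOLUTION:D157-DOOR2 (res-dim4-pi · F4-C · crossing-line class).  Host item
(DR-157-C): `stmt-ResolutionOfSingularities-16155`, helper.
-/

set_option linter.dupNamespace false -- mandated namespace of this single-conjunct summit

noncomputable section

open MvPolynomial Finset
open scoped BigOperators

namespace Summit.ResolutionOfSingularities.ResolutionOfSingularities.Theorems.PIDim4

namespace UnionLaw

open Literature.AlgebraicGeometry.Resolution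
open Literature.AlgebraicGeometry.Resolution.Hauser2010
open Literature.AlgebraicGeometry.Resolution.CentreBlowup

variable {K : Type} [Field K]

/-! ## §1 The degree mass of the support never decreases under a union-law spine step -/

/-- the **degree mass** of `F`: the sum of the total degrees of its monomials. OURS. [folklore] -/
def degMass (F : MvPolynomial (Fin 4) K) : ℕ := ∑ α ∈ F.support, α.degree

/-- Under permissibility (`q ≤ ord_U F`) and cleanliness the spine child is the chart transform itself and its
support is the `chartExponent`-image of the parent's. OURS. [folklore] -/
theorem support_spineChild {q : ℕ} {U : Finset (Fin 4)} {j : Fin 4} (hj : j ∈ U)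
    {F : MvPolynomial (Fin 4) K} (hclean : deletePthPowers q F = F) (hperm : (q : ℕ∞) ≤ ordAlong U F) :
    deletePthPowers q (chartTransform q U j F) = chartTransform q U j F ∧
      (chartTransform q U j F).support = F.support.image (chartExponent q U j) := by
  have hq := ComponentThreads.forall_le_degIn_of_le_ordAlong hperm
  exact ⟨Perm2Bound.deletePthPowers_chartTransform hj hq hclean,
    ComponentThreads.support_chartTransform_eq_image hj hq⟩

/-- `chartExponent` is injective on a permissible support. OURS. [folklore] -/
theorem chartExponent_injOn {q : ℕ} {U : Finset (Fin 4)} {j : Fin 4} (hj : j ∈ U)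
    {F : MvPolynomial (Fin 4) K} (hperm : (q : ℕ∞) ≤ ordAlong U F) :
    Set.InjOn (chartExponent q U j) ↑F.support := by
  have hq := ComponentThreads.forall_le_degIn_of_le_ordAlong hperm
  intro a ha b hb h
  have ha' := (Perm2Bound.mem_support_chartTransform_iff (K := K) hj hq (hq a ha)).mpr ha
  rw [h] at ha'
  -- `chartExponent b` lies in the support of the transform and comes from a unique parent monomial
  ext i
  by_cases hij : i = j
  · subst hij
    have h1 := congrArg (fun e : Fin 4 →₀ ℕ => e i) h
    simp only [chartExponent_apply_self] at h1
    -- `|a|_U - q = |b|_U - q` with both `≥ q`, and the other coordinates agree: so `a i = b i`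
    have hothers : ∀ k, k ≠ i → a k = b k := fun k hk => by
      have := congrArg (fun e : Fin 4 →₀ ℕ => e k) h
      simpa [chartExponent_apply_of_ne q U hk] using this
    have hE : degIn (U.erase i) a = degIn (U.erase i) b :=
      Finset.sum_congr rfl fun k hk => hothers k (Finset.ne_of_mem_erase hk)
    have hqa := hq a ha
    have hqb := hq b hb
    rw [degIn_eq_add_degIn_erase hj a, degIn_eq_add_degIn_erase hj b, hE] at h1
    rw [degIn_eq_add_degIn_erase hj a, hE] at hqa
    rw [degIn_eq_add_degIn_erase hj b] at hqb
    omega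
  · have := congrArg (fun e : Fin 4 →₀ ℕ => e i) h
    simpa [chartExponent_apply_of_ne q U hij] using this

/-- **The degree mass does not decrease along a union-law spine step**, and it is preserved iff the chart
transform is the identity on `F`. OURS. [folklore] -/
theorem degMass_le_and_eq_iff {q : ℕ} {U : Finset (Fin 4)} {j : Fin 4} (hj : j ∈ U)
    {F : MvPolynomial (Fin 4) K} (hclean : deletePthPowers q F = F) (hperm : (q : ℕ∞) ≤ ordAlong U F)
    (hlaw : ∀ α ∈ F.support, q ≤ degIn (U.erase j) α) :
    degMass F ≤ degMass (deletePthPowers q (chartTransform q U j F)) ∧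
      (degMass F = degMass (deletePthPowers q (chartTransform q U j F)) ↔ chartTransform q U j F = F) := by
  classical
  obtain ⟨hct, hsupp⟩ := support_spineChild hj hclean hperm
  have hinj := chartExponent_injOn (K := K) hj hperm
  have hmass : degMass (deletePthPowers q (chartTransform q U j F)) =
      ∑ α ∈ F.support, (chartExponent q U j α).degree := by
    unfold degMass
    rw [hct, hsupp, Finset.sum_image hinj]
  have hle : ∀ α ∈ F.support, α.degree ≤ (chartExponent q U j α).degree :=
    fun α hα => Finsupp.degree_mono (le_chartExponent_of_le q hj (hlaw α hα))
  refine ⟨?_, ?_, ?_⟩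
  · rw [hmass]
    exact Finset.sum_le_sum hle
  · -- equal mass + `α ≤ chartExponent α` coordinatewise ⇒ every exponent is fixed ⇒ identity transform
    intro hdeg
    rw [hmass] at hdeg
    unfold degMass at hdeg
    have hall := (Finset.sum_eq_sum_iff_of_le hle).mp hdeg
    refine chartTransform_eq_self q hj fun α hα => ?_
    have hq : q ≤ degIn U α := by
      rw [degIn_eq_add_degIn_erase hj]
      have := hlaw α hα
      omega
    refine (chartExponent_eq_self_iff q hj hq).mp ?_
    have hle' := le_chartExponent_of_le q hj (hlaw α hα)
    have hsum := hall α hα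
    rw [Finsupp.degree_eq_sum, Finsupp.degree_eq_sum] at hsum
    have hcoord := (Finset.sum_eq_sum_iff_of_le (fun i _ => hle' i)).mp hsum
    exact (Finsupp.ext fun i => hcoord i (Finset.mem_univ i)).symm
  · intro hid
    rw [hct, hid]

/-! ## §2 Periodic union-law spine runs are stationary -/

/-- **NO CYCLES, ONLY FIXED POINTS.**  A spine run `F (k+1) = deletePthPowers q (chartTransform q (U k) (j k) (F k))`
(`j k ∈ U k`), clean at the start, with `C_{U k}` permissible and the union-law inequality
`q ≤ |α|_{U k ∖ j k}` on every monomial of `F k` at every step, which is PERIODIC (`F n = F 0`, `n ≥ 1`) is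
STATIONARY: every step on the way is the identity. OURS (every field, every `q`). [folklore] -/
theorem spineRun_stationary_of_periodic (q : ℕ) (F : ℕ → MvPolynomial (Fin 4) K) (U : ℕ → Finset (Fin 4))
    (j : ℕ → Fin 4) (hj : ∀ k, j k ∈ U k)
    (hstep : ∀ k, F (k + 1) = deletePthPowers q (chartTransform q (U k) (j k) (F k)))
    (hclean : deletePthPowers q (F 0) = F 0) (hperm : ∀ k, (q : ℕ∞) ≤ ordAlong (U k) (F k))
    (hlaw : ∀ k, ∀ α ∈ (F k).support, q ≤ degIn ((U k).erase (j k)) α) {n : ℕ} (hper : F n = F 0) :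
    ∀ k, k < n → F (k + 1) = F k := by
  -- every state is clean
  have hcl : ∀ k, deletePthPowers q (F k) = F k := by
    intro k
    induction k with
    | zero => exact hclean
    | succ k _ => rw [hstep k]; exact PointBlowup.deletePthPowers_deletePthPowers q _
  -- the degree mass is monotone along the run
  have hmono : ∀ k, degMass (F k) ≤ degMass (F (k + 1)) := fun k => by
    rw [hstep k]; exact (degMass_le_and_eq_iff (hj k) (hcl k) (hperm k) (hlaw k)).1
  have hchain : ∀ a b, a ≤ b → degMass (F a) ≤ degMass (F b) := by
    intro a b hab
    induction hab with
    | refl => exact le_rfl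
    | step _ ih => exact ih.trans (hmono _)
  intro k hk
  have h1 : degMass (F k) ≤ degMass (F (k + 1)) := hmono k
  have h2 : degMass (F (k + 1)) ≤ degMass (F n) := hchain _ _ hk
  have h3 : degMass (F n) = degMass (F 0) := by rw [hper]
  have h4 : degMass (F 0) ≤ degMass (F k) := hchain _ _ (Nat.zero_le k)
  have heq : degMass (F k) = degMass (F (k + 1)) := by omega
  rw [hstep k] at heq ⊢
  have hid := ((degMass_le_and_eq_iff (hj k) (hcl k) (hperm k) (hlaw k)).2).mp heq
  rw [hid, hcl k]

/-! ## §3 Crossing lines satisfy the union law in every chart off the intersection -/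

omit [Field K] in
/-- **Crossing lines obey the union law**: if `U ⊇ S₁` with `C_{S₁}` permissible for `F` and the chart `j ∉ S₁`,
then every monomial of `F` has `(U ∖ {j})`-degree `≥ q`. OURS. [folklore] -/
theorem unionLaw_of_crossing [Field K] {q : ℕ} {U S₁ : Finset (Fin 4)} {j : Fin 4} (hS : S₁ ⊆ U) (hjS : j ∉ S₁)
    {F : MvPolynomial (Fin 4) K} (hperm : (q : ℕ∞) ≤ ordAlong S₁ F) :
    ∀ α ∈ F.support, q ≤ degIn (U.erase j) α := by
  intro α hα
  have h1 : q ≤ degIn S₁ α := by exact_mod_cast (le_ordAlong_iff.mp hperm) α hα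
  have hsub : S₁ ⊆ U.erase j := fun i hi => Finset.mem_erase.mpr ⟨fun h => hjS (h ▸ hi), hS hi⟩
  exact h1.trans (degIn_mono hsub α)

/-- **Periodic spine runs of crossing-line rules are fixed points**: centres `U k ⊇ S k` with `C_{S k}` and
`C_{U k}` permissible and charts `j k ∉ S k` (the chart misses one of the components whose union is blown up),
clean start, `F n = F 0` with `n ≥ 1` ⇒ stationary.  (This is why the located crossing-line specimens — `P₁`,
`P`, `Q`, FIX-X — are ONE-state regions.) OURS (every field, every `q`). [folklore] -/
theorem crossing_spineRun_stationary_of_periodic (q : ℕ) (F : ℕ → MvPolynomial (Fin 4) K)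
    (U S : ℕ → Finset (Fin 4)) (j : ℕ → Fin 4) (hj : ∀ k, j k ∈ U k) (hS : ∀ k, S k ⊆ U k)
    (hjS : ∀ k, j k ∉ S k)
    (hstep : ∀ k, F (k + 1) = deletePthPowers q (chartTransform q (U k) (j k) (F k)))
    (hclean : deletePthPowers q (F 0) = F 0) (hpermU : ∀ k, (q : ℕ∞) ≤ ordAlong (U k) (F k))
    (hpermS : ∀ k, (q : ℕ∞) ≤ ordAlong (S k) (F k)) {n : ℕ} (hper : F n = F 0) :
    ∀ k, k < n → F (k + 1) = F k :=
  spineRun_stationary_of_periodic q F U j hj hstep hclean hpermU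
    (fun k => unionLaw_of_crossing (hS k) (hjS k) (hpermS k)) hper

end UnionLaw

end Summit.ResolutionOfSingularities.ResolutionOfSingularities.Theorems.PIDim4

end
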